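import Literature.NumberTheory.GaloisRepresentations.LubinTateFrobeniusTwist
import HarnessLib

/-!
# Lubin–Tate's comparison series `ϑ`: `f' ∘ ϑ = ϑ^φ ∘ f`, `ϑ^φ = ϑ ∘ [u]_f`, `ϑ ∘ [a]_f = [a]_{f'} ∘ ϑ`

Topic `NumberTheory/GaloisRepresentations`; namespace
`Literature.NumberTheory.GaloisRepresentations.LubinTate` (continuation of
`LubinTateFrobeniusTwist.lean`).

Let `𝒪` be a Lubin–Tate base (`IsLTRing π₀ q`, e.g. the valuation ring of a local field `K` with
uniformiser `π₀`), `u ∈ 𝒪ˣ` a unit and `f ∈ 𝔉_{π₀}`, `f' ∈ 𝔉_{uπ₀}` Lubin–Tate series for the two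
uniformisers `π₀`, `π' = uπ₀`; and let `ι : 𝒪 → A` be a ring map into a `(π₀)`-adically complete
and separated ring `A` with an endomorphism `φ` FIXING `ι(𝒪)` and lifting the `q`-th power map
(`IsTwistBase (ι π₀) q φ`) — the model being `A = 𝒪̂_{K^nr}`, the completion of the maximal
unramified extension, with its Frobenius `φ` (Lubin–Tate 1965, p. 385; Cassels–Fröhlich VI §3.7).
Given a unit `ε ∈ A` with `φ(ε) = uε` (which exists over `𝒪̂_{K^nr}` by Lang's theorem, tree
`IsAbsArithFrob.exists_isUnit_eq_mul_galAut`), this file constructs and characterises LUBIN–TATE'S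
COMPARISON SERIES (Lubin–Tate 1965, the Lemma in the proof of Thm. 3, (16)–(18); Cassels–Fröhlich
VI §3.7 Lemma 1 (a)–(c); de Shalit I §1.3–1.5):

* `LubinTate.compSeries … = ϑ ∈ A⟦X⟧` with `ϑ ≡ εX (mod deg 2)` and **`f' ∘ ϑ = ϑ^φ ∘ f`**
  (`subst_compSeries`; the twisted Lubin–Tate lemma `exists_unique_twist` / `twLimit` of the
  previous file in one variable), and the one-variable twisted uniqueness `eq_of_subst_eq_subst_map`;
* **`ϑ^φ = ϑ ∘ [u]_f`** (`map_compSeries`; Lubin–Tate (16)): both sides solve the twisted equation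
  with linear term `φ(ε) = uε`;
* **`ϑ ∘ [a]_f = [a]_{f'} ∘ ϑ`** for every `a ∈ 𝒪` (`subst_hom_compSeries`; Lubin–Tate (18),
  `ϑ` is `𝒪`-linear), in particular `ϑ ∘ [π₀ⁿ]_f = [π₀ⁿ]_{f'} ∘ ϑ` (torsion of level `n` is carried
  to torsion of level `n`);
* bookkeeping: `IsLTSeries.map'` (change of coefficients), `map_map_eq_map` (series over `𝒪` are
  `φ`-fixed), the stability lemmas `subst_map_of_subst`, `subst_hom_of_subst`, `hom_subst_of_subst`.

Not here: the formal-group property `ϑ(F_f(X,Y)) = F_{f'}(ϑX, ϑY)` (Lubin–Tate (17); same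
argument in two variables), the evaluation at points of `𝔪_ℂ` and the reciprocity law (sequel).
No named facts.

## References

* [LubinTate1965] J. Lubin, J. Tate, *Formal complex multiplication in local fields*, Ann. of
  Math. 81 (1965), pp. 385–386 (the Lemma and (16)–(18) in the proof of Thm. 3).
* [CasselsFrohlichANT1967] J.-P. Serre, *Local class field theory*, Ch. VI of Cassels–Fröhlich
  (1967), §3.7 Lemma 1.
* [deShalit1987] E. de Shalit, *Iwasawa theory of elliptic curves with complex multiplication*
  (1987), Ch. I §1.3–§1.5.
-/

noncomputable section

open MvPowerSeries

namespace Literature.NumberTheory.GaloisRepresentations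

namespace LubinTate

variable {A : Type*} [CommRing A]

/-! ### Lubin–Tate's comparison series `ϑ` (abstract form) -/

section Comparison

variable {𝒪 : Type*} [CommRing 𝒪] (ι : 𝒪 →+* A) (φ : A →+* A) {π₀ : 𝒪} {q : ℕ}

/-- An LT series stays an LT series under a change of coefficient ring. [folklore] -/
theorem IsLTSeries.map' {π : 𝒪} {g : PowerSeries 𝒪} (hg : IsLTSeries π q g) :
    IsLTSeries (ι π) q (g.map ι) := by
  refine ⟨?_, ?_, fun n => ?_⟩
  · rw [← PowerSeries.coeff_zero_eq_constantCoeff_apply, PowerSeries.coeff_map,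
      PowerSeries.coeff_zero_eq_constantCoeff_apply, hg.constantCoeff_eq_zero, map_zero]
  · rw [PowerSeries.coeff_map, hg.coeff_one]
  · have h := map_dvd ι (hg.dvd_coeff_sub n)
    rw [map_sub] at h
    rw [PowerSeries.coeff_map]
    convert h using 2
    split_ifs <;> simp

variable {u₀ : 𝒪ˣ} {f f' : PowerSeries 𝒪}
  [IsAdicComplete (Ideal.span {ι π₀}) A] (hA : IsTwistBase (ι π₀) q φ)
  (hφι : ∀ a : 𝒪, φ (ι a) = ι a)
  (hf : IsLTSeries π₀ q f) (hf' : IsLTSeries ((u₀ : 𝒪) * π₀) q f')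
include hA hf hf'

/-- The unit `u` seen in `A`. [folklore] -/
abbrev unitMap (u₀ : 𝒪ˣ) : Aˣ := Units.map (ι : 𝒪 →* A) u₀

omit [IsAdicComplete (Ideal.span {ι π₀}) A] hA hf in
/-- `f'` over `A` is an LT series for `ι(u) ι(π)`. [folklore] -/
theorem isLTSeries_map_f' : IsLTSeries (((unitMap ι u₀ : Aˣ) : A) * ι π₀) q (f'.map ι) := by
  have h := hf'.map' ι
  rwa [map_mul] at h

omit [IsAdicComplete (Ideal.span {ι π₀}) A] hA hf hf' in
include hφι in
/-- Series with coefficients from `𝒪` are fixed by `φ`. [folklore] -/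
theorem map_map_eq_map (g : PowerSeries 𝒪) : (g.map ι).map φ = g.map ι := by
  ext n
  rw [PowerSeries.coeff_map, PowerSeries.coeff_map, hφι]

variable {ε : A} (hε : φ ε = ι u₀ * ε)
include hε

/-- **Lubin–Tate's comparison series `ϑ`**: the unique `ϑ ∈ A⟦X⟧` with `ϑ ≡ εX (mod deg 2)` and
`f' ∘ ϑ = ϑ^φ ∘ f`, for a unit `ε` with `φ(ε) = u ε` (Lubin–Tate 1965, Lemma p. 385: "there
exists `ϑ(X) ∈ 𝒪̂⟦X⟧` with `ϑ(X) ≡ εX mod deg 2` and `f' ∘ ϑ = ϑ^φ ∘ f`"; Cassels–Fröhlich VI §3.7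
Lemma 1). [cite: LubinTate1965, Lemma p. 385] [cite: CasselsFrohlichANT1967, Ch. VI §3.7 Lemma 1] -/
def compSeries : PowerSeries A :=
  twLimit (σ := Unit) φ hA (isLTSeries_map_f' ι hf') (hf.map' ι) (a := fun _ => ε)
    (fun _ => by rw [hε]; rfl)

/-- `ϑ` has no constant term. [cite: LubinTate1965, Lemma p. 385] -/
theorem constantCoeff_compSeries : PowerSeries.constantCoeff (compSeries ι φ hA hf hf' hε) = 0 :=
  constantCoeff_twLimit _ _ _ _ _

/-- `ϑ ≡ εX (mod deg 2)`. [cite: LubinTate1965, Lemma p. 385] -/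
theorem coeff_one_compSeries : PowerSeries.coeff 1 (compSeries ι φ hA hf hf' hε) = ε :=
  coeff_twLimit_single (σ := Unit) _ _ _ _ _ ()

omit [IsAdicComplete (Ideal.span {ι π₀}) A] hA hf hf' hε in
/-- One-variable spelling of the twisted defect: `f' ∘ Φ - Φ^φ ∘ f`. [folklore] -/
theorem twistDefect_unit (g' g : PowerSeries A) (Φ : PowerSeries A) :
    twistDefect (σ := Unit) φ g' g Φ = PowerSeries.subst Φ g' - PowerSeries.subst g (Φ.map φ) := by
  rw [twistDefect, compLeft, compRight_unit]
  rfl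

/-- **`f' ∘ ϑ = ϑ^φ ∘ f`.** [cite: LubinTate1965, Lemma p. 385] -/
theorem subst_compSeries :
    PowerSeries.subst (compSeries ι φ hA hf hf' hε) (f'.map ι) =
      PowerSeries.subst (f.map ι) ((compSeries ι φ hA hf hf' hε).map φ) := by
  have h := twistDefect_twLimit (σ := Unit) φ hA (isLTSeries_map_f' ι hf') (hf.map' ι) (a := fun _ => ε)
    (fun _ => by rw [hε]; rfl)
  rw [twistDefect_unit, sub_eq_zero] at h
  exact h

omit hε in
/-- **Twisted uniqueness** (one variable): two series without constant term, with the same linear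
coefficient and both satisfying `f' ∘ Ψ = Ψ^φ ∘ f`, are equal. [cite: LubinTate1965, Lemma p. 385] -/
theorem eq_of_subst_eq_subst_map {Ψ₁ Ψ₂ : PowerSeries A} (h₁ : PowerSeries.constantCoeff Ψ₁ = 0)
    (h₂ : PowerSeries.constantCoeff Ψ₂ = 0) (hlin : PowerSeries.coeff 1 Ψ₁ = PowerSeries.coeff 1 Ψ₂)
    (hΨ₁ : PowerSeries.subst Ψ₁ (f'.map ι) = PowerSeries.subst (f.map ι) (Ψ₁.map φ))
    (hΨ₂ : PowerSeries.subst Ψ₂ (f'.map ι) = PowerSeries.subst (f.map ι) (Ψ₂.map φ)) : Ψ₁ = Ψ₂ := by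
  refine eq_of_twistDefect_eq_zero (σ := Unit) φ hA (isLTSeries_map_f' ι hf') (hf.map' ι) h₁ h₂
    (fun i => ?_) ?_ ?_
  · exact hlin
  · rw [twistDefect_unit, hΨ₁, sub_self]
  · rw [twistDefect_unit, hΨ₂, sub_self]

omit [IsAdicComplete (Ideal.span {ι π₀}) A] hA hf hf' hε in
/-- `(g ∘ Ψ)^h = g^h ∘ Ψ^h` (one-variable spelling of Mathlib's `PowerSeries.map_subst`). [folklore] -/
theorem map_subst_one {Ψ : PowerSeries A} (hs : PowerSeries.HasSubst Ψ) (g : PowerSeries A)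
    (h : A →+* A) :
    PowerSeries.map h (PowerSeries.subst Ψ g) = PowerSeries.subst (PowerSeries.map h Ψ) (PowerSeries.map h g) :=
  PowerSeries.map_subst hs g

omit [IsAdicComplete (Ideal.span {ι π₀}) A] hA hf hf' hε in
/-- The same over a change of rings `ι : 𝒪 → A`. [folklore] -/
theorem map_subst_one' {Ψ : PowerSeries 𝒪} (hs : PowerSeries.HasSubst Ψ) (g : PowerSeries 𝒪) :
    PowerSeries.map ι (PowerSeries.subst Ψ g) = PowerSeries.subst (PowerSeries.map ι Ψ) (PowerSeries.map ι g) :=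
  PowerSeries.map_subst hs g

omit [IsAdicComplete (Ideal.span {ι π₀}) A] hA hf' hε in
include hφι in
/-- `Ψ ↦ Ψ^φ` preserves the twisted relation (as `f, f'` have `φ`-fixed coefficients). [folklore] -/
theorem subst_map_of_subst {Ψ : PowerSeries A} (h0 : PowerSeries.constantCoeff Ψ = 0)
    (hΨ : PowerSeries.subst Ψ (f'.map ι) = PowerSeries.subst (f.map ι) (Ψ.map φ)) :
    PowerSeries.subst (Ψ.map φ) (f'.map ι) = PowerSeries.subst (f.map ι) ((Ψ.map φ).map φ) := by
  have hs : PowerSeries.HasSubst Ψ := PowerSeries.HasSubst.of_constantCoeff_zero' h0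
  have hsf : PowerSeries.HasSubst (f.map ι) :=
    PowerSeries.HasSubst.of_constantCoeff_zero' (hf.map' ι).constantCoeff_eq_zero
  have h := congrArg (PowerSeries.map φ) hΨ
  rw [map_subst_one hs, map_subst_one hsf, map_map_eq_map ι φ hφι, map_map_eq_map ι φ hφι] at h
  exact h

variable (h𝒪 : IsLTRing π₀ q)

omit [IsAdicComplete (Ideal.span {ι π₀}) A] hA hf' hε in
include hφι h𝒪 in
/-- `Ψ ↦ Ψ ∘ [a]_f` preserves the twisted relation (`[a]_f` commutes with `f` and is `φ`-fixed).
[folklore] -/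
theorem subst_hom_of_subst {Ψ : PowerSeries A} (h0 : PowerSeries.constantCoeff Ψ = 0)
    (hΨ : PowerSeries.subst Ψ (f'.map ι) = PowerSeries.subst (f.map ι) (Ψ.map φ)) (a : 𝒪) :
    PowerSeries.subst (PowerSeries.subst ((hom h𝒪 hf hf a).map ι) Ψ) (f'.map ι) =
      PowerSeries.subst (f.map ι)
        (PowerSeries.map φ (PowerSeries.subst ((hom h𝒪 hf hf a).map ι) Ψ)) := by
  set h := (hom h𝒪 hf hf a).map ι with hh
  have hh0 : PowerSeries.constantCoeff h = 0 := by
    rw [hh, ← PowerSeries.coeff_zero_eq_constantCoeff_apply, PowerSeries.coeff_map,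
      PowerSeries.coeff_zero_eq_constantCoeff_apply, constantCoeff_hom, map_zero]
  have hs : PowerSeries.HasSubst h := PowerSeries.HasSubst.of_constantCoeff_zero' hh0
  have hsΨ : PowerSeries.HasSubst Ψ := PowerSeries.HasSubst.of_constantCoeff_zero' h0
  have hsΨφ : PowerSeries.HasSubst (Ψ.map φ) := by
    refine PowerSeries.HasSubst.of_constantCoeff_zero' ?_
    rw [← PowerSeries.coeff_zero_eq_constantCoeff_apply, PowerSeries.coeff_map,
      PowerSeries.coeff_zero_eq_constantCoeff_apply, h0, map_zero]
  have hsf : PowerSeries.HasSubst (f.map ι) :=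
    PowerSeries.HasSubst.of_constantCoeff_zero' (hf.map' ι).constantCoeff_eq_zero
  -- `f ∘ [a] = [a] ∘ f` over `A`
  have hcomm : PowerSeries.subst h (f.map ι) = PowerSeries.subst (f.map ι) h := by
    have h1 := congrArg (PowerSeries.map ι) (subst_hom h𝒪 hf hf a)
    rwa [map_subst_one' ι (PowerSeries.HasSubst.of_constantCoeff_zero' (constantCoeff_hom h𝒪 hf hf a)),
      map_subst_one' ι (PowerSeries.HasSubst.of_constantCoeff_zero' hf.constantCoeff_eq_zero)] at h1
  -- `[a]^φ = [a]`
  have hfix : h.map φ = h := map_map_eq_map ι φ hφι _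
  calc PowerSeries.subst (PowerSeries.subst h Ψ) (f'.map ι)
      = PowerSeries.subst h (PowerSeries.subst Ψ (f'.map ι)) := by
        rw [PowerSeries.subst_comp_subst_apply hsΨ hs]
    _ = PowerSeries.subst h (PowerSeries.subst (f.map ι) (Ψ.map φ)) := by rw [hΨ]
    _ = PowerSeries.subst (PowerSeries.subst h (f.map ι)) (Ψ.map φ) := by
        rw [PowerSeries.subst_comp_subst_apply hsf hs]
    _ = PowerSeries.subst (PowerSeries.subst (f.map ι) h) (Ψ.map φ) := by rw [hcomm]
    _ = PowerSeries.subst (f.map ι) (PowerSeries.subst h (Ψ.map φ)) := by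
        rw [PowerSeries.subst_comp_subst_apply hs hsf]
    _ = PowerSeries.subst (f.map ι) (PowerSeries.map φ (PowerSeries.subst h Ψ)) := by
        rw [map_subst_one hs, hfix]

include h𝒪 hφι in
/-- **`ϑ^φ = ϑ ∘ [u]_f`** (Lubin–Tate 1965, (16), p. 385; Cassels–Fröhlich VI §3.7 Lemma 1 (a)):
both sides have linear coefficient `φ(ε) = uε` and satisfy the twisted relation.
[cite: LubinTate1965, Lemma p. 385, (16)] [cite: CasselsFrohlichANT1967, Ch. VI §3.7 Lemma 1] -/
theorem map_compSeries :
    (compSeries ι φ hA hf hf' hε).map φ =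
      PowerSeries.subst ((hom h𝒪 hf hf (u₀ : 𝒪)).map ι) (compSeries ι φ hA hf hf' hε) := by
  set ϑ := compSeries ι φ hA hf hf' hε with hϑ
  have hϑ0 : PowerSeries.constantCoeff ϑ = 0 := constantCoeff_compSeries ι φ hA hf hf' hε
  have hu0 : PowerSeries.constantCoeff ((hom h𝒪 hf hf (u₀ : 𝒪)).map ι) = 0 := by
    rw [← PowerSeries.coeff_zero_eq_constantCoeff_apply, PowerSeries.coeff_map,
      PowerSeries.coeff_zero_eq_constantCoeff_apply, constantCoeff_hom, map_zero]
  refine eq_of_subst_eq_subst_map ι φ hA hf hf' ?_ ?_ ?_ ?_ ?_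
  · rw [← PowerSeries.coeff_zero_eq_constantCoeff_apply, PowerSeries.coeff_map,
      PowerSeries.coeff_zero_eq_constantCoeff_apply, hϑ0, map_zero]
  · rw [PowerSeries.subst_def]
    exact MvPowerSeries.constantCoeff_subst_eq_zero
      (MvPowerSeries.hasSubst_of_constantCoeff_zero fun _ => hu0) (fun _ => hu0) hϑ0
  · rw [PowerSeries.coeff_map, coeff_one_compSeries, hε]
    -- linear coefficient of `ϑ ∘ [u]`: `ε · ι u`
    have h1 : PowerSeries.coeff 1 (PowerSeries.subst ((hom h𝒪 hf hf (u₀ : 𝒪)).map ι) ϑ) =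
        PowerSeries.coeff 1 ϑ * PowerSeries.coeff 1 ((hom h𝒪 hf hf (u₀ : 𝒪)).map ι) := by
      have h := coeff_single_subst (σ := Unit) (τ := Unit) (F := ϑ)
        (b := fun _ => ((hom h𝒪 hf hf (u₀ : 𝒪)).map ι : PowerSeries A)) (fun _ => hu0) ()
      rw [Fintype.sum_unique] at h
      exact h
    rw [h1, coeff_one_compSeries, PowerSeries.coeff_map, coeff_one_hom, mul_comm]
  · exact subst_map_of_subst ι φ hφι hf hϑ0 (subst_compSeries ι φ hA hf hf' hε)
  · exact subst_hom_of_subst ι φ hφι hf h𝒪 hϑ0 (subst_compSeries ι φ hA hf hf' hε) _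

variable (h𝒪' : IsLTRing ((u₀ : 𝒪) * π₀) q)

omit [IsAdicComplete (Ideal.span {ι π₀}) A] hA hε in
include hφι h𝒪' in
/-- `Ψ ↦ [a]_{f'} ∘ Ψ` preserves the twisted relation (`[a]_{f'}` commutes with `f'` and is
`φ`-fixed). [folklore] -/
theorem hom_subst_of_subst {Ψ : PowerSeries A} (h0 : PowerSeries.constantCoeff Ψ = 0)
    (hΨ : PowerSeries.subst Ψ (f'.map ι) = PowerSeries.subst (f.map ι) (Ψ.map φ)) (a : 𝒪) :
    PowerSeries.subst (PowerSeries.subst Ψ ((hom h𝒪' hf' hf' a).map ι)) (f'.map ι) =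
      PowerSeries.subst (f.map ι)
        (PowerSeries.map φ (PowerSeries.subst Ψ ((hom h𝒪' hf' hf' a).map ι))) := by
  set h := (hom h𝒪' hf' hf' a).map ι with hh
  have hh0 : PowerSeries.constantCoeff h = 0 := by
    rw [hh, ← PowerSeries.coeff_zero_eq_constantCoeff_apply, PowerSeries.coeff_map,
      PowerSeries.coeff_zero_eq_constantCoeff_apply, constantCoeff_hom, map_zero]
  have hs : PowerSeries.HasSubst h := PowerSeries.HasSubst.of_constantCoeff_zero' hh0
  have hsΨ : PowerSeries.HasSubst Ψ := PowerSeries.HasSubst.of_constantCoeff_zero' h0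
  have hsΨφ : PowerSeries.HasSubst (Ψ.map φ) := by
    refine PowerSeries.HasSubst.of_constantCoeff_zero' ?_
    rw [← PowerSeries.coeff_zero_eq_constantCoeff_apply, PowerSeries.coeff_map,
      PowerSeries.coeff_zero_eq_constantCoeff_apply, h0, map_zero]
  have hsf : PowerSeries.HasSubst (f.map ι) :=
    PowerSeries.HasSubst.of_constantCoeff_zero' (hf.map' ι).constantCoeff_eq_zero
  have hsf' : PowerSeries.HasSubst (f'.map ι) :=
    PowerSeries.HasSubst.of_constantCoeff_zero' (hf'.map' ι).constantCoeff_eq_zero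
  -- `f' ∘ [a]' = [a]' ∘ f'` over `A`
  have hcomm : PowerSeries.subst h (f'.map ι) = PowerSeries.subst (f'.map ι) h := by
    have h1 := congrArg (PowerSeries.map ι) (subst_hom h𝒪' hf' hf' a)
    rwa [map_subst_one' ι (PowerSeries.HasSubst.of_constantCoeff_zero' (constantCoeff_hom h𝒪' hf' hf' a)),
      map_subst_one' ι (PowerSeries.HasSubst.of_constantCoeff_zero' hf'.constantCoeff_eq_zero)] at h1
  have hfix : h.map φ = h := map_map_eq_map ι φ hφι _
  calc PowerSeries.subst (PowerSeries.subst Ψ h) (f'.map ι)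
      = PowerSeries.subst Ψ (PowerSeries.subst h (f'.map ι)) := by
        rw [PowerSeries.subst_comp_subst_apply hs hsΨ]
    _ = PowerSeries.subst Ψ (PowerSeries.subst (f'.map ι) h) := by rw [hcomm]
    _ = PowerSeries.subst (PowerSeries.subst Ψ (f'.map ι)) h := by
        rw [PowerSeries.subst_comp_subst_apply hsf' hsΨ]
    _ = PowerSeries.subst (PowerSeries.subst (f.map ι) (Ψ.map φ)) h := by rw [hΨ]
    _ = PowerSeries.subst (f.map ι) (PowerSeries.subst (Ψ.map φ) h) := by
        rw [PowerSeries.subst_comp_subst_apply hsΨφ hsf]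
    _ = PowerSeries.subst (f.map ι) (PowerSeries.map φ (PowerSeries.subst Ψ h)) := by
        rw [map_subst_one hsΨ, hfix]

include hφι h𝒪 h𝒪' in
/-- **`ϑ ∘ [a]_f = [a]_{f'} ∘ ϑ`** for all `a ∈ 𝒪`: `ϑ` is `𝒪`-linear (Lubin–Tate 1965, (18),
p. 386; Cassels–Fröhlich VI §3.7 Lemma 1 (c)): both sides have linear coefficient `εa` and satisfy
the twisted relation. [cite: LubinTate1965, Lemma p. 385, (18)] [cite: CasselsFrohlichANT1967, Ch. VI §3.7 Lemma 1] -/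
theorem subst_hom_compSeries (a : 𝒪) :
    PowerSeries.subst ((hom h𝒪 hf hf a).map ι) (compSeries ι φ hA hf hf' hε) =
      PowerSeries.subst (compSeries ι φ hA hf hf' hε) ((hom h𝒪' hf' hf' a).map ι) := by
  set ϑ := compSeries ι φ hA hf hf' hε with hϑ
  have hϑ0 : PowerSeries.constantCoeff ϑ = 0 := constantCoeff_compSeries ι φ hA hf hf' hε
  have ha0 : PowerSeries.constantCoeff ((hom h𝒪 hf hf a).map ι) = 0 := by
    rw [← PowerSeries.coeff_zero_eq_constantCoeff_apply, PowerSeries.coeff_map,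
      PowerSeries.coeff_zero_eq_constantCoeff_apply, constantCoeff_hom, map_zero]
  have ha0' : PowerSeries.constantCoeff ((hom h𝒪' hf' hf' a).map ι) = 0 := by
    rw [← PowerSeries.coeff_zero_eq_constantCoeff_apply, PowerSeries.coeff_map,
      PowerSeries.coeff_zero_eq_constantCoeff_apply, constantCoeff_hom, map_zero]
  refine eq_of_subst_eq_subst_map ι φ hA hf hf' ?_ ?_ ?_ ?_ ?_
  · rw [PowerSeries.subst_def]
    exact MvPowerSeries.constantCoeff_subst_eq_zero
      (MvPowerSeries.hasSubst_of_constantCoeff_zero fun _ => ha0) (fun _ => ha0) hϑ0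
  · rw [PowerSeries.subst_def]
    exact MvPowerSeries.constantCoeff_subst_eq_zero
      (MvPowerSeries.hasSubst_of_constantCoeff_zero fun _ => hϑ0) (fun _ => hϑ0) ha0'
  · have h1 := coeff_single_subst (σ := Unit) (τ := Unit) (F := ϑ)
      (b := fun _ => ((hom h𝒪 hf hf a).map ι : PowerSeries A)) (fun _ => ha0) ()
    have h2 := coeff_single_subst (σ := Unit) (τ := Unit) (F := ((hom h𝒪' hf' hf' a).map ι : PowerSeries A))
      (b := fun _ => ϑ) (fun _ => hϑ0) ()
    rw [Fintype.sum_unique] at h1 h2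
    rw [PowerSeries.subst_def, PowerSeries.subst_def]
    refine h1.trans (Eq.trans ?_ h2.symm)
    show PowerSeries.coeff 1 ϑ * PowerSeries.coeff 1 ((hom h𝒪 hf hf a).map ι) =
      PowerSeries.coeff 1 ((hom h𝒪' hf' hf' a).map ι) * PowerSeries.coeff 1 ϑ
    rw [PowerSeries.coeff_map, PowerSeries.coeff_map, coeff_one_hom, coeff_one_hom, mul_comm]
  · exact subst_hom_of_subst ι φ hφι hf h𝒪 hϑ0 (subst_compSeries ι φ hA hf hf' hε) _
  · exact hom_subst_of_subst ι φ hφι hf hf' h𝒪' hϑ0 (subst_compSeries ι φ hA hf hf' hε) _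

end Comparison

end LubinTate

end Literature.NumberTheory.GaloisRepresentations

end
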